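import Summits.CriticalPhenomena.PercolationContinuityZ3.Theorems.PercNearOneGluingNoHeavyLowerTailFKHullPortTASInductionS
import Summits.CriticalPhenomena.PercolationContinuityZ3.Theorems.PercNearOneGluingNoHeavyLowerTailFKStarHLayer
import HarnessLib

/-!
# FK sub-lane: `T^S ≥ 0` and Lemma `Δ_N^S` for `φ_{𝐩,q}` — unconditional ((★^H) discharged)

Support file (`--supports stmt-CriticalPhenomena-4575`), FK sub-lane `prim-bschramm-fk-2` (gen 3); builds on p205010 (kernel theorem,
internal audit signed; external expert review pending).  No definitions, no named facts, no sorries; standard axioms.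

* `FK.taBS_singleton_le` — the hypothesis `hStarS` of `FK.taQS_nonneg_of_starS` / `FK.deltaNS_nonneg_of_starS` ((★^H) at the
  singleton `N = {v'}` in `P_v` shape, every weight vector `u`): `B^S(u, {v'}) ≤ Z_u·(1 − φ_u(y↮S, y↔v')/φ_u(y↮S))·Cov_u(g(C_x), 1{y↔S})`,
  from `FK.starH_rc` (hp-8's (K7) for `φ_{𝐩,q}`) and its corollary `FK.starH_le_cov_rc` (the case `φ_u(y ↮ S) = 0`); the only
  extra observation is that the world covariance vanishes when `y` lies in the cluster of `v'`.
* `FK.taQS_nonneg` — **`T^S ≥ 0` for the random-cluster measure**, every `q ≥ 1`, every finite weighted graph, owner `x ∈ S`, observer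
  `y ∉ S`, every avoided set `X` whose weight-one pairs lie inside `X`, every marker, every monotone test function: prim-hp-7's (Htw) =
  the (K9)-diagonal of hp-8's PROOF-S5-ALL-R, for `φ_{𝐩,q}` — bschramm/FK-Q2.md §12.6(c) is a tree theorem.
* `FK.deltaNS_nonneg` — Lemma `Δ_N^S` for `φ_{𝐩,q}`, unconditional.
[cite: Gladkov2024, Thm. 3.2 (p. 4)] [cite: VandenbergHaggstromKahn2005, Thm. 1.4 (p. 7), Thm. 2.1 (p. 9), §2.1 Lemmas 2.3–2.4 (p. 10)]
[cite: Grimmett2006, Thm. (3.1)(a), Thm. (3.8)(b) (p. 39), eq. (1.20)]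
-/

noncomputable section

namespace Summit.CriticalPhenomena.PercolationContinuityZ3.Theorems.FK

open MeasureTheory Set Literature.Probability.LatticeModels Literature.Probability.Percolation
open Literature.Probability.Percolation.DecisionTree (ind ind_of_mem ind_of_not_mem ind_nonneg)
open Literature.Probability.Percolation.BHK2006 (rcMass rcMass_nonneg delW rcMeasureW_real_eq_sum_rcMass)
open Summit.CriticalPhenomena.PercolationContinuityZ3.Theorems.HullPort (cut avoidEv connS)
open scoped Classical

variable {V : Type*} [Fintype V]

/-- If the observer `y` is joined to `v'`, the world `G − cut_{{v'}}` isolates `y` and `c^S = 0` (`y ∉ S`). [folklore] -/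
theorem taCS_singleton_eq_zero_of_reachable (u : Sym2 V → unitInterval) (q : ℝ) (x : V) {S : Set V} {y : V} (hyS : y ∉ S)
    (v' : V) (g : Set (Sym2 V) → ℝ) {ω : BondConfig V} (h : (openGraph ω).Reachable v' y) :
    taCS u q x S y {v'} g ω = 0 := by
  have hB : ∀ e : Sym2 V, y ∈ e → e ∈ cut ({v'} : Set V) ω := fun e hye => ⟨y, hye, v', Set.mem_singleton _, h⟩
  unfold taCS
  have h1 := wE_mul_ind_connS_eq_zero u q hyS hB (fun η => g (openEdgeCluster η x))
  have h2 := wE_mul_ind_connS_eq_zero u q hyS hB (fun _ => 1)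
  have h2' : wE u q (cut ({v'} : Set V) ω) (ind (connS S y)) = 0 := by
    rw [← h2]; unfold wE; simp only [one_mul]
  rw [h1, h2']
  ring

/-- **(★^H) at singletons in `P_v` shape, for `φ_{𝐩,q}`** — the hypothesis `hStarS` of `FK.taQS_nonneg_of_starS`: for `x ∈ S`, `y ∉ S`,
every weight vector `u`, every `v'` and every monotone `g`,
`B^S(u, {v'}) ≤ Z_u · (1 − φ_u(y ↮ S, y ↔ v')/φ_u(y ↮ S)) · Cov_u(g(C_x), 1{y ↔ S})` (from `FK.starH_rc` and `FK.starH_le_cov_rc`).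
[cite: Gladkov2024, Thm. 3.2 (p. 4)] [cite: VandenbergHaggstromKahn2005, Thm. 1.4 (p. 7), §2.1 Lemmas 2.3–2.4 (p. 10)] -/
theorem taBS_singleton_le (u : Sym2 V → unitInterval) {q : ℝ} (hq : 1 ≤ q) {x : V} {S : Set V} (hxS : x ∈ S) {y : V}
    (hyS : y ∉ S) (v' : V) (g : Set (Sym2 V) → ℝ) (hg : Monotone g) :
    taBS u q x S y {v'} g ≤ rcPartitionFunctionW u q ∅ *
      ((1 - wE u q ∅ (ind ((connS S y : Set (Set (Sym2 V)))ᶜ ∩ openConn y v')) /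
            wE u q ∅ (ind (connS S y : Set (Set (Sym2 V)))ᶜ)) *
        (wE u q ∅ (fun η => g (openEdgeCluster η x) * ind (connS S y) η) -
          wE u q ∅ (fun η => g (openEdgeCluster η x)) * wE u q ∅ (ind (connS S y)))) := by
  classical
  have hq0 : 0 < q := one_pos.trans_le hq
  haveI := isProbabilityMeasure_rcMeasureW u hq0 (∅ : Set V)
  have hZ : 0 < rcPartitionFunctionW u q ∅ := rcPartitionFunctionW_pos u hq0 ∅
  have hmeas : ∀ T : Set (BondConfig V), MeasurableSet T := fun _ => MeasurableSet.of_discrete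
  -- the two descriptions of `{S ↔ y}` and `{v' ↔ y}`
  have hYc : {ζ : BondConfig V | ∃ s ∈ S, (openGraph ζ).Reachable s y} = (connS S y : Set (Set (Sym2 V))) := by
    ext ζ
    simp only [Set.mem_setOf_eq, connS]
    exact ⟨fun ⟨s, hs, h⟩ => ⟨s, hs, h.symm⟩, fun ⟨s, hs, h⟩ => ⟨s, hs, h.symm⟩⟩
  have hNc : {ζ : BondConfig V | ∃ n ∈ ({v'} : Set V), (openGraph ζ).Reachable n y} = (openConn y v' : Set (BondConfig V)) := by
    ext ζ
    simp only [Set.mem_setOf_eq, Set.mem_singleton_iff, exists_eq_left, openConn]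
    exact ⟨fun h => h.symm, fun h => h.symm⟩
  have h1 := starH_rc u hq y hxS ({v'} : Set V) g hg
  have h2 := starH_le_cov_rc u hq x y S ({v'} : Set V) g hg
  rw [hYc, hNc] at h1
  rw [hYc] at h2
  set Y : Set (BondConfig V) := (connS S y : Set (Set (Sym2 V))) with hY
  set Nv : Set (BondConfig V) := (openConn y v' : Set (BondConfig V)) with hNv
  set G : Set (BondConfig V) := {ω : BondConfig V | (∀ n ∈ ({v'} : Set V), ¬ (openGraph ω).Reachable n x) ∧
    ∀ n ∈ ({v'} : Set V), ¬ (openGraph ω).Reachable n y} with hG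
  -- the world covariance is `taCS`
  have ec : ∀ ω : BondConfig V,
      (∑ η, rcMass (delW u (cut ({v'} : Set V) ω)) q η * (g (openEdgeCluster η x) * ind Y η)) -
        (∑ η, rcMass (delW u (cut ({v'} : Set V) ω)) q η * g (openEdgeCluster η x)) *
          (∑ η, rcMass (delW u (cut ({v'} : Set V) ω)) q η * ind Y η) = taCS u q x S y {v'} g ω := fun ω => rfl
  simp only [ec] at h1 h2
  -- world expectations at `B = ∅` and probabilities as sums
  have hwE : ∀ φ : Set (Sym2 V) → ℝ, wE u q ∅ φ = ∑ η, rcMass u q η * φ η := fun φ => by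
    unfold wE; rw [delW_empty]
  have hsplit : (rcMeasureW u q ∅).real (Yᶜ ∩ Nvᶜ) = (rcMeasureW u q ∅).real Yᶜ - (rcMeasureW u q ∅).real (Yᶜ ∩ Nv) := by
    have := measureReal_inter_add_sdiff (μ := rcMeasureW u q ∅) (s := Yᶜ) (h := measure_ne_top _ _) (hmeas Nv)
    rw [Set.sdiff_eq_compl_inter, Set.inter_comm Nvᶜ Yᶜ] at this
    linarith
  rw [hsplit] at h1
  rw [rcMeasureW_real_eq_sum_rcMass u hq0, rcMeasureW_real_eq_sum_rcMass u hq0, rcMeasureW_real_eq_sum_rcMass u hq0] at h1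
  rw [rcMeasureW_real_eq_sum_rcMass u hq0] at h2
  rw [hwE, hwE, hwE, hwE, hwE]
  -- `B^S(u,{v'}) = Z · Y^H({v'})`
  have hB : taBS u q x S y {v'} g = rcPartitionFunctionW u q ∅ * ∑ ω, rcMass u q ω * (ind G ω * taCS u q x S y {v'} g ω) := by
    unfold taBS
    rw [Finset.mul_sum]
    refine Finset.sum_congr rfl fun ω _ => ?_
    have hmass : rcWeightW u q ∅ ω = rcPartitionFunctionW u q ∅ * rcMass u q ω := by
      unfold rcMass; field_simp
    rw [hmass]
    by_cases hvy : (openGraph ω).Reachable v' y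
    · rw [taCS_singleton_eq_zero_of_reachable u q x hyS v' g hvy]; ring
    · have hind : ind (avoidEv x ({v'} : Set V)) ω = ind G ω := by
        have hiff : ω ∈ avoidEv x ({v'} : Set V) ↔ ω ∈ G := by
          simp only [avoidEv, hG, Set.mem_setOf_eq, Set.mem_singleton_iff, forall_eq]
          exact ⟨fun h => ⟨fun h' => h h'.symm, hvy⟩, fun h h' => h.1 h'.symm⟩
        by_cases hω : ω ∈ avoidEv x ({v'} : Set V)
        · rw [ind_of_mem hω, ind_of_mem (hiff.1 hω)]
        · rw [ind_of_not_mem hω, ind_of_not_mem (fun h => hω (hiff.2 h))]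
      rw [hind]; ring
  rw [hB]
  set YH := ∑ ω, rcMass u q ω * (ind G ω * taCS u q x S y {v'} g ω) with hYH
  set C := (∑ ω, rcMass u q ω * (g (openEdgeCluster ω x) * ind Y ω)) -
    (∑ ω, rcMass u q ω * g (openEdgeCluster ω x)) * ∑ ω, rcMass u q ω * ind Y ω with hC
  set P := ∑ ω, rcMass u q ω * ind Yᶜ ω with hP
  set PN := ∑ ω, rcMass u q ω * ind (Yᶜ ∩ Nv) ω with hPN
  refine mul_le_mul_of_nonneg_left ?_ hZ.le
  have hP0 : 0 ≤ P := Finset.sum_nonneg fun ω _ => mul_nonneg (rcMass_nonneg u hq0 ω) (ind_nonneg _ _)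
  by_cases hPz : P = 0
  · rw [hPz, div_zero, sub_zero, one_mul]
    exact h2
  · have hPpos : 0 < P := lt_of_le_of_ne hP0 (Ne.symm hPz)
    have key : YH ≤ (P - PN) * C / P := by
      rw [le_div_iff₀ hPpos]; exact h1
    have e : (1 - PN / P) * C = (P - PN) * C / P := by field_simp
    rw [e]; exact key

/-- **`T^S ≥ 0` for the random-cluster measure `φ_{𝐩,q}`, `q ≥ 1` — unconditional** (prim-hp-7's (Htw) = the (K9)-diagonal of
hp-8's PROOF-S5-ALL-R, for `φ_{𝐩,q}`; bschramm/FK-Q2.md §12.6(c)): for an owner `x ∈ S`, an observer `y ∉ S`, every avoided set `X`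
whose weight-one pairs lie inside `X`, every marker `z` and every monotone test function `g`, `Q^S = A^S·b^S − a^S·B^S ≥ 0`.
`FK.taQS_nonneg_of_starS` with `hStarS` supplied by `FK.taBS_singleton_le`.
[cite: Gladkov2024, Thm. 3.2 (p. 4)] [cite: VandenbergHaggstromKahn2005, Thm. 1.4 (p. 7), Thm. 2.1 (p. 9), §2.1 Lemmas 2.3–2.4 (p. 10)]
[cite: Grimmett2006, Thm. (3.1)(a), Thm. (3.8)(b), eq. (1.20)] -/
theorem taQS_nonneg {q : ℝ} (hq : 1 ≤ q) {x : V} {S : Set V} (hxS : x ∈ S) (y : V) (hyS : y ∉ S)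
    (g : Set (Sym2 V) → ℝ) (hg : Monotone g) (w : Sym2 V → unitInterval) (X : Set V)
    (hINV : ∀ p : Sym2 V, ((w p : unitInterval) : ℝ) = 1 → ∀ u ∈ p, u ∈ X) (z : V) :
    0 ≤ taQS w q x S y z X g :=
  taQS_nonneg_of_starS hq x S y hyS g hg (fun u v' => taBS_singleton_le u hq hxS hyS v' g hg) w X hINV z

/-- **Lemma `Δ_N^S` for the random-cluster measure `φ_{𝐩,q}`, `q ≥ 1` — unconditional**: for `x ∈ S`, `y ∉ S`, an avoided set `X`
containing every endpoint of a weight-one pair, a fractional pair `ab` with `a ∈ X` and a monotone `g`,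
`B^S(w^{ab→0}, X)·b^S(w^{ab→1}, X ∪ {b}) ≥ B^S(w^{ab→1}, X ∪ {b})·b^S(w^{ab→0}, X)`.
[cite: Gladkov2024, Thm. 3.2 (p. 4)] [cite: VandenbergHaggstromKahn2005, Thm. 1.4 (p. 7), Thm. 2.1 (p. 9)] [cite: Grimmett2006, Thm. (3.1)(a)] -/
theorem deltaNS_nonneg {q : ℝ} (hq : 1 ≤ q) {x : V} {S : Set V} (hxS : x ∈ S) (y : V) (hyS : y ∉ S)
    (g : Set (Sym2 V) → ℝ) (hg : Monotone g) (w : Sym2 V → unitInterval) (X : Set V)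
    (hINV : ∀ p : Sym2 V, ((w p : unitInterval) : ℝ) = 1 → ∀ u ∈ p, u ∈ X)
    {a b : V} (ha : a ∈ X) (hab : a ≠ b) (h0 : 0 < ((w s(a, b) : unitInterval) : ℝ))
    (h1 : ((w s(a, b) : unitInterval) : ℝ) < 1) :
    0 ≤ taBS (Function.update w s(a, b) 0) q x S y X g * tabS (Function.update w s(a, b) 1) q S y (insert b X) -
        taBS (Function.update w s(a, b) 1) q x S y (insert b X) g * tabS (Function.update w s(a, b) 0) q S y X :=
  deltaNS_nonneg_of_starS hq x S y hyS g hg (fun u v' => taBS_singleton_le u hq hxS hyS v' g hg) w X hINV ha hab h0 h1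

end Summit.CriticalPhenomena.PercolationContinuityZ3.Theorems.FK

end
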